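import Mathlib
import Summits.Ventures.PercRepro2.RootPairSep
import Summits.Ventures.PercRepro2.RootPairSepPM

/-!
# Root-pair separation for the TYPED bracket `β₁ = (HALF-PM⁺)_L + (HALF-PM⁺)_H + A`
(blind cell PercRepro2, mine-2 g21; proofs/MINE2-CUTU.md §10 Theorem 7′).

`β₁` is the cleared three-copy form of the typed (PM): the L-half of `RootPairSepPM.lean`, its
mirror (roles of `a₁`, `a₂` exchanged for `b`, `u`) and the `a₃`-inactive piece
`A = (P(uU Q) − P(Q))·[Cov-bracket(L_b, H_o) + Cov-bracket(H_b, L_o)]`.  When the roots separate: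
* (i) `b` alone on one side: `β₁ = 0`;  (ii) `o` alone on one side: `β₁ = 0`;
* (iii) `u` alone on one side: `β₁ ≥ 0` (BHK 1.3 for both clusters and BHK 1.4);
* (iv) `o, u, b` on one side: `β₁ = P(r₂⁻¹ Q)³ · β₁(G[V₁])` — in `RootPairSepTypedRestrict.lean`.
Hence the typed (PM) reduces to the blocks containing both roots and all three marks; and `A ≥ 0`
on every graph (`a3piece_nonneg`), so `β₁` dominates the sum of the two weighted halves. -/

namespace Summit.Ventures.PercRepro2

namespace RootPairSep

open SepPair

section Sep

variable {V : Type*} {E : Type*}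

/-- Root-pair separation is symmetric in the two sides. -/
lemma IsRootPairSep.symm {ends : E → Sym2 V} {a₁ a₂ : V} {V₁ V₂ : Set V}
    (hs : IsRootPairSep ends a₁ a₂ V₁ V₂) : IsRootPairSep ends a₁ a₂ V₂ V₁ := by
  obtain ⟨h1, h2, h3, h4⟩ := hs
  refine ⟨?_, ?_, ?_, ?_⟩
  · exact ⟨h1.2, h1.1⟩
  · exact ⟨h2.2, h2.1⟩
  · intro x hx; exact h3 ⟨hx.2, hx.1⟩
  · intro e x y h; exact (h4 e x y h).symm

/-- The connection event is symmetric in its endpoints. -/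
lemma connEvent_comm (ends : E → Sym2 V) (x y : V) : connEvent ends x y = connEvent ends y x := by
  ext ω; exact ⟨fun h => conn_symm h, fun h => conn_symm h⟩

end Sep

section Main

variable {V : Type*} {E : Type*} [Fintype E] [DecidableEq E] {R : Type*} [CommRing R]


/-- **Theorem 7′ (i).**  If `b` lies on one side of the root pair and `o`, `u` on the other, the typed bracket `β₁` vanishes. -/
theorem beta1_eq_zero_of_b_alone [LinearOrder R] [IsStrictOrderedRing R] (p : E → R)
    {ends : E → Sym2 V} {a₁ a₂ : V}
    {V₁ V₂ : Set V} (hs : IsRootPairSep ends a₁ a₂ V₁ V₂) {o u b : V}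
    (ho : o ∈ V₁) (hu : u ∈ V₁) (hb : b ∈ V₂) :
    prob p (connEvent ends a₁ a₂)ᶜ *
          (prob p (connEvent ends a₁ a₂)ᶜ * prob p (connEvent ends a₁ b ∩ connEvent ends a₂ u ∩ (connEvent ends a₁ o ∪ connEvent ends a₂ o) ∩ (connEvent ends a₁ a₂)ᶜ) -
            prob p (connEvent ends a₁ b ∩ (connEvent ends a₁ a₂)ᶜ) * prob p (connEvent ends a₂ u ∩ (connEvent ends a₁ o ∪ connEvent ends a₂ o) ∩ (connEvent ends a₁ a₂)ᶜ)) -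
        prob p ((connEvent ends a₁ o ∪ connEvent ends a₂ o) ∩ (connEvent ends a₁ a₂)ᶜ) *
          (prob p (connEvent ends a₁ a₂)ᶜ * prob p (connEvent ends a₁ b ∩ connEvent ends a₂ u ∩ (connEvent ends a₁ a₂)ᶜ) -
            prob p (connEvent ends a₁ b ∩ (connEvent ends a₁ a₂)ᶜ) * prob p (connEvent ends a₂ u ∩ (connEvent ends a₁ a₂)ᶜ)) -
        prob p (connEvent ends a₁ a₂)ᶜ *
          (prob p (connEvent ends a₁ a₂)ᶜ * prob p (connEvent ends a₁ b ∩ connEvent ends a₂ o ∩ (connEvent ends a₁ a₂)ᶜ) -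
            prob p (connEvent ends a₁ b ∩ (connEvent ends a₁ a₂)ᶜ) * prob p (connEvent ends a₂ o ∩ (connEvent ends a₁ a₂)ᶜ)) +
        prob p (connEvent ends a₁ a₂)ᶜ *
          (prob p (connEvent ends a₁ a₂)ᶜ * prob p (connEvent ends a₂ b ∩ connEvent ends a₁ u ∩ (connEvent ends a₁ o ∪ connEvent ends a₂ o) ∩ (connEvent ends a₁ a₂)ᶜ) -
            prob p (connEvent ends a₂ b ∩ (connEvent ends a₁ a₂)ᶜ) * prob p (connEvent ends a₁ u ∩ (connEvent ends a₁ o ∪ connEvent ends a₂ o) ∩ (connEvent ends a₁ a₂)ᶜ)) -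
        prob p ((connEvent ends a₁ o ∪ connEvent ends a₂ o) ∩ (connEvent ends a₁ a₂)ᶜ) *
          (prob p (connEvent ends a₁ a₂)ᶜ * prob p (connEvent ends a₂ b ∩ connEvent ends a₁ u ∩ (connEvent ends a₁ a₂)ᶜ) -
            prob p (connEvent ends a₂ b ∩ (connEvent ends a₁ a₂)ᶜ) * prob p (connEvent ends a₁ u ∩ (connEvent ends a₁ a₂)ᶜ)) -
        prob p (connEvent ends a₁ a₂)ᶜ *
          (prob p (connEvent ends a₁ a₂)ᶜ * prob p (connEvent ends a₂ b ∩ connEvent ends a₁ o ∩ (connEvent ends a₁ a₂)ᶜ) -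
            prob p (connEvent ends a₂ b ∩ (connEvent ends a₁ a₂)ᶜ) * prob p (connEvent ends a₁ o ∩ (connEvent ends a₁ a₂)ᶜ)) +
        (prob p ((connEvent ends a₁ u ∪ connEvent ends a₂ u) ∩ (connEvent ends a₁ a₂)ᶜ) - prob p (connEvent ends a₁ a₂)ᶜ) *
          (prob p (connEvent ends a₁ a₂)ᶜ * prob p (connEvent ends a₁ b ∩ connEvent ends a₂ o ∩ (connEvent ends a₁ a₂)ᶜ) - prob p (connEvent ends a₁ b ∩ (connEvent ends a₁ a₂)ᶜ) * prob p (connEvent ends a₂ o ∩ (connEvent ends a₁ a₂)ᶜ) +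
            prob p (connEvent ends a₁ a₂)ᶜ * prob p (connEvent ends a₂ b ∩ connEvent ends a₁ o ∩ (connEvent ends a₁ a₂)ᶜ) - prob p (connEvent ends a₂ b ∩ (connEvent ends a₁ a₂)ᶜ) * prob p (connEvent ends a₁ o ∩ (connEvent ends a₁ a₂)ᶜ)) = 0 := by
  classical
  have hL := halfL_eq_zero_of_b_alone p hs ho hu hb
  set D := (connEvent ends a₁ a₂)ᶜ with hDdef
  set Lb := connEvent ends a₁ b
  set Hb := connEvent ends a₂ b
  set Lu := connEvent ends a₁ u
  set Hu := connEvent ends a₂ u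
  set Lo := connEvent ends a₁ o
  set Ho := connEvent ends a₂ o
  have sLb : ∀ ω ∈ D, ω ∈ Lb ↔ restrictTo (side₁ ends V₁)ᶜ ω ∈ Lb := fun _ hD => conn_side₂ hs hD (Or.inl rfl) hb
  have sHb : ∀ ω ∈ D, ω ∈ Hb ↔ restrictTo (side₁ ends V₁)ᶜ ω ∈ Hb := fun _ hD => conn_side₂ hs hD (Or.inr rfl) hb
  have sLu : ∀ ω ∈ D, ω ∈ Lu ↔ restrictTo (side₁ ends V₁) ω ∈ Lu := fun _ hD => conn_side₁ hs hD (Or.inl rfl) hu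
  have sLo : ∀ ω ∈ D, ω ∈ Lo ↔ restrictTo (side₁ ends V₁) ω ∈ Lo := fun _ hD => conn_side₁ hs hD (Or.inl rfl) ho
  have sHo : ∀ ω ∈ D, ω ∈ Ho ↔ restrictTo (side₁ ends V₁) ω ∈ Ho := fun _ hD => conn_side₁ hs hD (Or.inr rfl) ho
  have soU := side_union sLo sHo
  -- side 1 = u, o ; side 2 = b
  have J1 := prob_side_mul p hs (X := Lu ∩ (Lo ∪ Ho)) (Y := Hb) (side_inter sLu soU) sHb
  have J2 := prob_side_mul p hs (X := Lu) (Y := Hb) sLu sHb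
  have J3 := prob_side_mul p hs (X := Lo) (Y := Hb) sLo sHb
  have K3 := prob_side_mul p hs (X := Ho) (Y := Lb) sHo sLb
  have e1 : Hb ∩ Lu ∩ (Lo ∪ Ho) ∩ D = Lu ∩ (Lo ∪ Ho) ∩ Hb ∩ D := by
    ext ω; simp only [Set.mem_inter_iff, Set.mem_union]; tauto
  have e2 : Hb ∩ Lu ∩ D = Lu ∩ Hb ∩ D := by
    ext ω; simp only [Set.mem_inter_iff]; tauto
  have e3 : Hb ∩ Lo ∩ D = Lo ∩ Hb ∩ D := by
    ext ω; simp only [Set.mem_inter_iff]; tauto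
  have e4 : Lb ∩ Ho ∩ D = Ho ∩ Lb ∩ D := by
    ext ω; simp only [Set.mem_inter_iff]; tauto
  rw [e1, e2, e3, e4]
  rw [e4] at hL
  linear_combination hL + prob p D * J1 - prob p ((Lo ∪ Ho) ∩ D) * J2 - prob p D * J3 +
    (prob p ((Lu ∪ Hu) ∩ D) - prob p D) * (K3 + J3)

/-- **Theorem 7′ (ii).**  If `b` and `u` lie on one side and `o` on the other, the typed bracket `β₁` vanishes. -/
theorem beta1_eq_zero_of_o_alone [LinearOrder R] [IsStrictOrderedRing R] (p : E → R)
    {ends : E → Sym2 V} {a₁ a₂ : V}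
    {V₁ V₂ : Set V} (hs : IsRootPairSep ends a₁ a₂ V₁ V₂) {o u b : V}
    (ho : o ∈ V₁) (hu : u ∈ V₂) (hb : b ∈ V₂) :
    prob p (connEvent ends a₁ a₂)ᶜ *
          (prob p (connEvent ends a₁ a₂)ᶜ * prob p (connEvent ends a₁ b ∩ connEvent ends a₂ u ∩ (connEvent ends a₁ o ∪ connEvent ends a₂ o) ∩ (connEvent ends a₁ a₂)ᶜ) -
            prob p (connEvent ends a₁ b ∩ (connEvent ends a₁ a₂)ᶜ) * prob p (connEvent ends a₂ u ∩ (connEvent ends a₁ o ∪ connEvent ends a₂ o) ∩ (connEvent ends a₁ a₂)ᶜ)) -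
        prob p ((connEvent ends a₁ o ∪ connEvent ends a₂ o) ∩ (connEvent ends a₁ a₂)ᶜ) *
          (prob p (connEvent ends a₁ a₂)ᶜ * prob p (connEvent ends a₁ b ∩ connEvent ends a₂ u ∩ (connEvent ends a₁ a₂)ᶜ) -
            prob p (connEvent ends a₁ b ∩ (connEvent ends a₁ a₂)ᶜ) * prob p (connEvent ends a₂ u ∩ (connEvent ends a₁ a₂)ᶜ)) -
        prob p (connEvent ends a₁ a₂)ᶜ *
          (prob p (connEvent ends a₁ a₂)ᶜ * prob p (connEvent ends a₁ b ∩ connEvent ends a₂ o ∩ (connEvent ends a₁ a₂)ᶜ) -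
            prob p (connEvent ends a₁ b ∩ (connEvent ends a₁ a₂)ᶜ) * prob p (connEvent ends a₂ o ∩ (connEvent ends a₁ a₂)ᶜ)) +
        prob p (connEvent ends a₁ a₂)ᶜ *
          (prob p (connEvent ends a₁ a₂)ᶜ * prob p (connEvent ends a₂ b ∩ connEvent ends a₁ u ∩ (connEvent ends a₁ o ∪ connEvent ends a₂ o) ∩ (connEvent ends a₁ a₂)ᶜ) -
            prob p (connEvent ends a₂ b ∩ (connEvent ends a₁ a₂)ᶜ) * prob p (connEvent ends a₁ u ∩ (connEvent ends a₁ o ∪ connEvent ends a₂ o) ∩ (connEvent ends a₁ a₂)ᶜ)) -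
        prob p ((connEvent ends a₁ o ∪ connEvent ends a₂ o) ∩ (connEvent ends a₁ a₂)ᶜ) *
          (prob p (connEvent ends a₁ a₂)ᶜ * prob p (connEvent ends a₂ b ∩ connEvent ends a₁ u ∩ (connEvent ends a₁ a₂)ᶜ) -
            prob p (connEvent ends a₂ b ∩ (connEvent ends a₁ a₂)ᶜ) * prob p (connEvent ends a₁ u ∩ (connEvent ends a₁ a₂)ᶜ)) -
        prob p (connEvent ends a₁ a₂)ᶜ *
          (prob p (connEvent ends a₁ a₂)ᶜ * prob p (connEvent ends a₂ b ∩ connEvent ends a₁ o ∩ (connEvent ends a₁ a₂)ᶜ) -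
            prob p (connEvent ends a₂ b ∩ (connEvent ends a₁ a₂)ᶜ) * prob p (connEvent ends a₁ o ∩ (connEvent ends a₁ a₂)ᶜ)) +
        (prob p ((connEvent ends a₁ u ∪ connEvent ends a₂ u) ∩ (connEvent ends a₁ a₂)ᶜ) - prob p (connEvent ends a₁ a₂)ᶜ) *
          (prob p (connEvent ends a₁ a₂)ᶜ * prob p (connEvent ends a₁ b ∩ connEvent ends a₂ o ∩ (connEvent ends a₁ a₂)ᶜ) - prob p (connEvent ends a₁ b ∩ (connEvent ends a₁ a₂)ᶜ) * prob p (connEvent ends a₂ o ∩ (connEvent ends a₁ a₂)ᶜ) +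
            prob p (connEvent ends a₁ a₂)ᶜ * prob p (connEvent ends a₂ b ∩ connEvent ends a₁ o ∩ (connEvent ends a₁ a₂)ᶜ) - prob p (connEvent ends a₂ b ∩ (connEvent ends a₁ a₂)ᶜ) * prob p (connEvent ends a₁ o ∩ (connEvent ends a₁ a₂)ᶜ)) = 0 := by
  classical
  have hL := halfL_eq_zero_of_o_alone p hs ho hu hb
  set D := (connEvent ends a₁ a₂)ᶜ with hDdef
  set Lb := connEvent ends a₁ b
  set Hb := connEvent ends a₂ b
  set Lu := connEvent ends a₁ u
  set Hu := connEvent ends a₂ u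
  set Lo := connEvent ends a₁ o
  set Ho := connEvent ends a₂ o
  have sLb : ∀ ω ∈ D, ω ∈ Lb ↔ restrictTo (side₁ ends V₁)ᶜ ω ∈ Lb := fun _ hD => conn_side₂ hs hD (Or.inl rfl) hb
  have sHb : ∀ ω ∈ D, ω ∈ Hb ↔ restrictTo (side₁ ends V₁)ᶜ ω ∈ Hb := fun _ hD => conn_side₂ hs hD (Or.inr rfl) hb
  have sLu : ∀ ω ∈ D, ω ∈ Lu ↔ restrictTo (side₁ ends V₁)ᶜ ω ∈ Lu := fun _ hD => conn_side₂ hs hD (Or.inl rfl) hu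
  have sLo : ∀ ω ∈ D, ω ∈ Lo ↔ restrictTo (side₁ ends V₁) ω ∈ Lo := fun _ hD => conn_side₁ hs hD (Or.inl rfl) ho
  have sHo : ∀ ω ∈ D, ω ∈ Ho ↔ restrictTo (side₁ ends V₁) ω ∈ Ho := fun _ hD => conn_side₁ hs hD (Or.inr rfl) ho
  have soU := side_union sLo sHo
  -- side 1 = o ; side 2 = b, u
  have J1 := prob_side_mul p hs (X := Lo ∪ Ho) (Y := Hb ∩ Lu) soU (side_inter sHb sLu)
  have J2 := prob_side_mul p hs (X := Lo ∪ Ho) (Y := Lu) soU sLu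
  have J3 := prob_side_mul p hs (X := Lo) (Y := Hb) sLo sHb
  have K3 := prob_side_mul p hs (X := Ho) (Y := Lb) sHo sLb
  have e1 : Hb ∩ Lu ∩ (Lo ∪ Ho) ∩ D = (Lo ∪ Ho) ∩ (Hb ∩ Lu) ∩ D := by
    ext ω; simp only [Set.mem_inter_iff, Set.mem_union]; tauto
  have e2 : Lu ∩ (Lo ∪ Ho) ∩ D = (Lo ∪ Ho) ∩ Lu ∩ D := by
    ext ω; simp only [Set.mem_inter_iff, Set.mem_union]; tauto
  have e3 : Hb ∩ Lo ∩ D = Lo ∩ Hb ∩ D := by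
    ext ω; simp only [Set.mem_inter_iff]; tauto
  have e4 : Lb ∩ Ho ∩ D = Ho ∩ Lb ∩ D := by
    ext ω; simp only [Set.mem_inter_iff]; tauto
  rw [e1, e2, e3, e4]
  rw [e4] at hL
  linear_combination hL + prob p D * J1 - prob p (Hb ∩ D) * J2 - prob p D * J3 +
    (prob p ((Lu ∪ Hu) ∩ D) - prob p D) * (K3 + J3)

/-- **Theorem 7′ (iii).**  If `b` and `o` lie on one side and `u` on the other, the typed bracket `β₁` is nonnegative (BHK 1.3 for both clusters, BHK 1.4). -/
theorem beta1_nonneg_of_u_alone [Fintype V] [DecidableEq V] [LinearOrder R]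
    [IsStrictOrderedRing R] (p : E → R) (hp : IsProbVec p) {ends : E → Sym2 V} {a₁ a₂ : V}
    {V₁ V₂ : Set V} (hs : IsRootPairSep ends a₁ a₂ V₁ V₂) {o u b : V}
    (ho : o ∈ V₂) (hu : u ∈ V₁) (hb : b ∈ V₂) :
    0 ≤
    prob p (connEvent ends a₁ a₂)ᶜ *
          (prob p (connEvent ends a₁ a₂)ᶜ * prob p (connEvent ends a₁ b ∩ connEvent ends a₂ u ∩ (connEvent ends a₁ o ∪ connEvent ends a₂ o) ∩ (connEvent ends a₁ a₂)ᶜ) -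
            prob p (connEvent ends a₁ b ∩ (connEvent ends a₁ a₂)ᶜ) * prob p (connEvent ends a₂ u ∩ (connEvent ends a₁ o ∪ connEvent ends a₂ o) ∩ (connEvent ends a₁ a₂)ᶜ)) -
        prob p ((connEvent ends a₁ o ∪ connEvent ends a₂ o) ∩ (connEvent ends a₁ a₂)ᶜ) *
          (prob p (connEvent ends a₁ a₂)ᶜ * prob p (connEvent ends a₁ b ∩ connEvent ends a₂ u ∩ (connEvent ends a₁ a₂)ᶜ) -
            prob p (connEvent ends a₁ b ∩ (connEvent ends a₁ a₂)ᶜ) * prob p (connEvent ends a₂ u ∩ (connEvent ends a₁ a₂)ᶜ)) -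
        prob p (connEvent ends a₁ a₂)ᶜ *
          (prob p (connEvent ends a₁ a₂)ᶜ * prob p (connEvent ends a₁ b ∩ connEvent ends a₂ o ∩ (connEvent ends a₁ a₂)ᶜ) -
            prob p (connEvent ends a₁ b ∩ (connEvent ends a₁ a₂)ᶜ) * prob p (connEvent ends a₂ o ∩ (connEvent ends a₁ a₂)ᶜ)) +
        prob p (connEvent ends a₁ a₂)ᶜ *
          (prob p (connEvent ends a₁ a₂)ᶜ * prob p (connEvent ends a₂ b ∩ connEvent ends a₁ u ∩ (connEvent ends a₁ o ∪ connEvent ends a₂ o) ∩ (connEvent ends a₁ a₂)ᶜ) -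
            prob p (connEvent ends a₂ b ∩ (connEvent ends a₁ a₂)ᶜ) * prob p (connEvent ends a₁ u ∩ (connEvent ends a₁ o ∪ connEvent ends a₂ o) ∩ (connEvent ends a₁ a₂)ᶜ)) -
        prob p ((connEvent ends a₁ o ∪ connEvent ends a₂ o) ∩ (connEvent ends a₁ a₂)ᶜ) *
          (prob p (connEvent ends a₁ a₂)ᶜ * prob p (connEvent ends a₂ b ∩ connEvent ends a₁ u ∩ (connEvent ends a₁ a₂)ᶜ) -
            prob p (connEvent ends a₂ b ∩ (connEvent ends a₁ a₂)ᶜ) * prob p (connEvent ends a₁ u ∩ (connEvent ends a₁ a₂)ᶜ)) -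
        prob p (connEvent ends a₁ a₂)ᶜ *
          (prob p (connEvent ends a₁ a₂)ᶜ * prob p (connEvent ends a₂ b ∩ connEvent ends a₁ o ∩ (connEvent ends a₁ a₂)ᶜ) -
            prob p (connEvent ends a₂ b ∩ (connEvent ends a₁ a₂)ᶜ) * prob p (connEvent ends a₁ o ∩ (connEvent ends a₁ a₂)ᶜ)) +
        (prob p ((connEvent ends a₁ u ∪ connEvent ends a₂ u) ∩ (connEvent ends a₁ a₂)ᶜ) - prob p (connEvent ends a₁ a₂)ᶜ) *
          (prob p (connEvent ends a₁ a₂)ᶜ * prob p (connEvent ends a₁ b ∩ connEvent ends a₂ o ∩ (connEvent ends a₁ a₂)ᶜ) - prob p (connEvent ends a₁ b ∩ (connEvent ends a₁ a₂)ᶜ) * prob p (connEvent ends a₂ o ∩ (connEvent ends a₁ a₂)ᶜ) +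
            prob p (connEvent ends a₁ a₂)ᶜ * prob p (connEvent ends a₂ b ∩ connEvent ends a₁ o ∩ (connEvent ends a₁ a₂)ᶜ) - prob p (connEvent ends a₂ b ∩ (connEvent ends a₁ a₂)ᶜ) * prob p (connEvent ends a₁ o ∩ (connEvent ends a₁ a₂)ᶜ)) := by
  classical
  have hL := halfL_nonneg_of_u_alone p hp hs ho hu hb
  have B1 := bhk_same_cluster_events p hp ends a₂ a₁ (𝓤 := {W : Set V | b ∈ W})
    (𝓥 := {W : Set V | o ∈ W}) (fun _ _ h hW => h hW) (fun _ _ h hW => h hW)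
  rw [RProduct.clusterInEvent_mem_eq, RProduct.clusterInEvent_mem_eq,
    connEvent_comm ends a₂ a₁] at B1
  have B2 := bhk_cross_cluster p hp ends a₁ a₂ (𝓤 := {W : Set V | b ∈ W})
    (𝓥 := {W : Set V | o ∈ W}) (fun _ _ h hW => h hW) (fun _ _ h hW => h hW)
  rw [RProduct.clusterInEvent_mem_eq, RProduct.clusterInEvent_mem_eq] at B2
  have B3 := bhk_cross_cluster p hp ends a₁ a₂ (𝓤 := {W : Set V | o ∈ W})
    (𝓥 := {W : Set V | b ∈ W}) (fun _ _ h hW => h hW) (fun _ _ h hW => h hW)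
  rw [RProduct.clusterInEvent_mem_eq, RProduct.clusterInEvent_mem_eq] at B3
  set D := (connEvent ends a₁ a₂)ᶜ with hDdef
  set Lb := connEvent ends a₁ b
  set Hb := connEvent ends a₂ b
  set Lu := connEvent ends a₁ u
  set Hu := connEvent ends a₂ u
  set Lo := connEvent ends a₁ o
  set Ho := connEvent ends a₂ o
  have sLb : ∀ ω ∈ D, ω ∈ Lb ↔ restrictTo (side₁ ends V₁)ᶜ ω ∈ Lb := fun _ hD => conn_side₂ hs hD (Or.inl rfl) hb
  have sHb : ∀ ω ∈ D, ω ∈ Hb ↔ restrictTo (side₁ ends V₁)ᶜ ω ∈ Hb := fun _ hD => conn_side₂ hs hD (Or.inr rfl) hb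
  have sLu : ∀ ω ∈ D, ω ∈ Lu ↔ restrictTo (side₁ ends V₁) ω ∈ Lu := fun _ hD => conn_side₁ hs hD (Or.inl rfl) hu
  have sLo : ∀ ω ∈ D, ω ∈ Lo ↔ restrictTo (side₁ ends V₁)ᶜ ω ∈ Lo := fun _ hD => conn_side₂ hs hD (Or.inl rfl) ho
  have sHo : ∀ ω ∈ D, ω ∈ Ho ↔ restrictTo (side₁ ends V₁)ᶜ ω ∈ Ho := fun _ hD => conn_side₂ hs hD (Or.inr rfl) ho
  have soU := side_union sLo sHo
  -- side 1 = u ; side 2 = b, o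
  have K1 := prob_side_mul p hs (X := Lu) (Y := Hb ∩ (Lo ∪ Ho)) sLu (side_inter sHb soU)
  have K2 := prob_side_mul p hs (X := Lu) (Y := Lo ∪ Ho) sLu soU
  have K3 := prob_side_mul p hs (X := Lu) (Y := Hb) sLu sHb
  have e1 : Hb ∩ Lu ∩ (Lo ∪ Ho) ∩ D = Lu ∩ (Hb ∩ (Lo ∪ Ho)) ∩ D := by
    ext ω; simp only [Set.mem_inter_iff, Set.mem_union]; tauto
  have e2 : Hb ∩ Lu ∩ D = Lu ∩ Hb ∩ D := by
    ext ω; simp only [Set.mem_inter_iff]; tauto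
  rw [e1, e2]
  -- the disjoint splits of `oU = Lo ⊔ Ho` on `D`
  have hdisj : ∀ X : Set (Config E), Disjoint (X ∩ Lo ∩ D) (X ∩ Ho ∩ D) := by
    intro X
    rw [Set.disjoint_left]
    rintro ω ⟨⟨_, hLo⟩, hD⟩ ⟨⟨_, hHo⟩, _⟩
    exact hD (conn_trans hLo (conn_symm hHo))
  have split : ∀ X : Set (Config E), prob p (X ∩ (Lo ∪ Ho) ∩ D) =
      prob p (X ∩ Lo ∩ D) + prob p (X ∩ Ho ∩ D) := by
    intro X
    rw [← prob_union_of_disjoint p (hdisj X)]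
    congr 1
    ext ω; simp only [Set.mem_inter_iff, Set.mem_union]; tauto
  have s1 := split Hb
  have s2 : prob p ((Lo ∪ Ho) ∩ D) = prob p (Lo ∩ D) + prob p (Ho ∩ D) := by
    have := split Set.univ
    simpa only [Set.univ_inter] using this
  have e3 : Hb ∩ Lo ∩ D = Lo ∩ Hb ∩ D := by
    ext ω; simp only [Set.mem_inter_iff]; tauto
  rw [e3] at s1 ⊢
  have hl : 0 ≤ prob p (Lu ∩ D) := prob_nonneg hp _
  have hla : prob p (Lu ∩ D) ≤ prob p D := prob_inter_le_right hp _ _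
  have hua : prob p ((Lu ∪ Hu) ∩ D) ≤ prob p D := prob_inter_le_right hp _ _
  -- the H-half identity
  have keyH : prob p D * (prob p D * prob p (Lu ∩ (Hb ∩ (Lo ∪ Ho)) ∩ D) -
        prob p (Hb ∩ D) * prob p (Lu ∩ (Lo ∪ Ho) ∩ D)) -
      prob p ((Lo ∪ Ho) ∩ D) * (prob p D * prob p (Lu ∩ Hb ∩ D) -
        prob p (Hb ∩ D) * prob p (Lu ∩ D)) -
      prob p D * (prob p D * prob p (Lo ∩ Hb ∩ D) - prob p (Hb ∩ D) * prob p (Lo ∩ D)) =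
      prob p (Lu ∩ D) * (prob p D * prob p (Hb ∩ Ho ∩ D) - prob p (Hb ∩ D) * prob p (Ho ∩ D)) -
        (prob p D - prob p (Lu ∩ D)) *
          (prob p D * prob p (Lo ∩ Hb ∩ D) - prob p (Hb ∩ D) * prob p (Lo ∩ D)) := by
    linear_combination (prob p D) * K1 - prob p (Hb ∩ D) * K2 - prob p ((Lo ∪ Ho) ∩ D) * K3 +
      prob p D * prob p (Lu ∩ D) * s1 - prob p (Hb ∩ D) * prob p (Lu ∩ D) * s2
  have hH : 0 ≤ prob p (Lu ∩ D) * (prob p D * prob p (Hb ∩ Ho ∩ D) -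
        prob p (Hb ∩ D) * prob p (Ho ∩ D)) -
      (prob p D - prob p (Lu ∩ D)) *
        (prob p D * prob p (Lo ∩ Hb ∩ D) - prob p (Hb ∩ D) * prob p (Lo ∩ D)) := by
    have h1 : 0 ≤ prob p (Lu ∩ D) * (prob p D * prob p (Hb ∩ Ho ∩ D) -
        prob p (Hb ∩ D) * prob p (Ho ∩ D)) := mul_nonneg hl (by linarith [B1])
    have h2 : (prob p D - prob p (Lu ∩ D)) *
        (prob p D * prob p (Lo ∩ Hb ∩ D) - prob p (Hb ∩ D) * prob p (Lo ∩ D)) ≤ 0 :=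
      mul_nonpos_of_nonneg_of_nonpos (by linarith) (by linarith [B3])
    linarith
  have hA : 0 ≤ (prob p ((Lu ∪ Hu) ∩ D) - prob p D) *
      (prob p D * prob p (Lb ∩ Ho ∩ D) - prob p (Lb ∩ D) * prob p (Ho ∩ D) +
        prob p D * prob p (Lo ∩ Hb ∩ D) - prob p (Hb ∩ D) * prob p (Lo ∩ D)) :=
    mul_nonneg_of_nonpos_of_nonpos (by linarith) (by linarith [B2, B3])
  linarith [hL, keyH, hH, hA]

/-- The `a₃`-inactive piece `A = (P(uU Q) − P(Q))·[Cov-bracket(L_b, H_o) + Cov-bracket(H_b, L_o)]` is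
nonnegative on EVERY graph (no separation needed): the first factor is `≤ 0` and both brackets are
`≤ 0` by BHK 1.4.  Hence the typed bracket `β₁` dominates the sum of the two weighted halves. -/
theorem a3piece_nonneg [Fintype V] [DecidableEq V] [LinearOrder R] [IsStrictOrderedRing R]
    (p : E → R) (hp : IsProbVec p) (ends : E → Sym2 V) (a₁ a₂ o u b : V) :
    0 ≤ (prob p ((connEvent ends a₁ u ∪ connEvent ends a₂ u) ∩ (connEvent ends a₁ a₂)ᶜ) -
          prob p (connEvent ends a₁ a₂)ᶜ) *
        (prob p (connEvent ends a₁ a₂)ᶜ *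
              prob p (connEvent ends a₁ b ∩ connEvent ends a₂ o ∩ (connEvent ends a₁ a₂)ᶜ) -
            prob p (connEvent ends a₁ b ∩ (connEvent ends a₁ a₂)ᶜ) *
              prob p (connEvent ends a₂ o ∩ (connEvent ends a₁ a₂)ᶜ) +
          prob p (connEvent ends a₁ a₂)ᶜ *
              prob p (connEvent ends a₂ b ∩ connEvent ends a₁ o ∩ (connEvent ends a₁ a₂)ᶜ) -
            prob p (connEvent ends a₂ b ∩ (connEvent ends a₁ a₂)ᶜ) *
              prob p (connEvent ends a₁ o ∩ (connEvent ends a₁ a₂)ᶜ)) := by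
  classical
  have B2 := bhk_cross_cluster p hp ends a₁ a₂ (𝓤 := {W : Set V | b ∈ W})
    (𝓥 := {W : Set V | o ∈ W}) (fun _ _ h hW => h hW) (fun _ _ h hW => h hW)
  rw [RProduct.clusterInEvent_mem_eq, RProduct.clusterInEvent_mem_eq] at B2
  have B3 := bhk_cross_cluster p hp ends a₁ a₂ (𝓤 := {W : Set V | o ∈ W})
    (𝓥 := {W : Set V | b ∈ W}) (fun _ _ h hW => h hW) (fun _ _ h hW => h hW)
  rw [RProduct.clusterInEvent_mem_eq, RProduct.clusterInEvent_mem_eq] at B3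
  have e : connEvent ends a₂ b ∩ connEvent ends a₁ o ∩ (connEvent ends a₁ a₂)ᶜ =
      connEvent ends a₁ o ∩ connEvent ends a₂ b ∩ (connEvent ends a₁ a₂)ᶜ := by
    ext ω; simp only [Set.mem_inter_iff]; tauto
  rw [e]
  have hua : prob p ((connEvent ends a₁ u ∪ connEvent ends a₂ u) ∩ (connEvent ends a₁ a₂)ᶜ) ≤
      prob p (connEvent ends a₁ a₂)ᶜ := prob_inter_le_right hp _ _
  exact mul_nonneg_of_nonpos_of_nonpos (by linarith) (by linarith [B2, B3])

end Main

end RootPairSep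

end Summit.Ventures.PercRepro2
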